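/-
Copyright: cell pub-balaban-gaps (YM BLITZ Y1, track G1), seat g1-p2 GEN 4 (unit `pub-balaban-gaps-g1-p2`).  Row (D4) NODE O,
OBJECT ∕ MECHANISM level: the «all three mechanisms» model term asked for by g1-plan-1 (L-4 ∕ L-5): Γ-kernel slot AND precision
slot genuine local kernel families, covariance slot by the Neumann step, reference covariance `C = (1 + Re H(0,0))⁻¹` real
symmetric positive definite — and (v)⁺ `ExistsUniformAcrossSmall` for families of such terms across tori with ONE package.
HONEST FRAMING: a MODEL family; nothing of Bałaban's constructed or asserted; (D4) NOT discharged (instance 0∕1); NOT BetaPertH,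
NOT continuum, NOT Clay.
-/
import Summits.QuantumFields.BalabanUV.Gaps.D4WalkNeumann
import Summits.QuantumFields.BalabanUV.Gaps.D4WalkSum
import Summits.QuantumFields.BalabanUV.Gaps.D4WalkModelAcross

/-!
# `Gaps.D4WalkModelFull` — a model (2.14)-term with local Γ-kernel, local precision `1 + H` and Neumann covariance, and
# (v)⁺ across tori for families of such terms (cell pub-balaban-gaps, seat g1-p2 gen 4)

HONEST DEPENDENCY (cell pub-balaban, verbatim): continuum YM on T⁴ ⇐ BetaPertH ∧ nine spine estimates (0/9 proved);
BetaPertH ⇐ (D1) ∧ (D4) ∧ CAP+tail.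

WHAT.  `Gaps/D4WalkModelAcross` (INTENT-18) inhabited the row-(D4) first-missing-lemma SHAPE `ExistsUniformAcrossSmall` with a
torus-uniform package but a FREE precision slot.  Here the precision is `A(σ,u) = 1 + H(σ,u)` for a second local datum `H`
(`B13LocalKernelWalks.LocalTerms`, square on the row bonds), so that all three printed mechanisms act: the σ-part of (2.16)
through the σ-carrying terms of `G` and `H` ([II] p. 13, (1.11)), the `u`-analyticity on the bigger ball ([II] p. 15), and the
covariance `(1 + H)⁻¹` by the Neumann ∕ walk expansion ([B9] (3.130), p. 422) with the margin smallness `q < 1` — the last via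
this seat's `D4WalkNeumann.jointWalkExpansion_inv` over ne5's T9, BY NAME.  The reference covariance `C = (1 + H₀)⁻¹`,
`H₀ = Re H(0,0)` real symmetric, is positive definite under the HYPOTHESIS `(1 + H₀).PosDef` (dischargeable from a row-sum
smallness of `|H₀|` — Schur's bound; kept as a named input here), and `hC0` is PROVED (the complex inverse of a real matrix is real).
* §1 transport of the walk shapes along an equality of kernel families (`K` enters only `hasSum`);
* §2 `FullModelTerm`, `refH`, `FullModelTerm.toKernels` (`A2 = 1 + H`, `G2 = G`, `Γ₀ = Re G(0,0)`, `C = (1 + H₀)⁻¹`);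
* §3 `FullModelTerm.termWalkData` — ONE package `(R, ε₀, κ₀ − 2μ, K̄_G, 1 + K̄_H, (1 − q)⁻¹, R_σ)`,
  `K̄_• = λ_•e^{κ₁m_J}e^{ρ₀r}·n_B·c_μ`, `q = (mc_μ)²K̄_Hc_μ²` (only `λ_H` is small; `λ_G` free, plan-1 N20-1): Γ-slot `jointWalkExpansion_local`, precision `jointWalkExpansion_add` (identity ⊕ `H`), covariance
  `jointWalkExpansion_inv` (seed = identity, direction = `H`, two row-sum steps `μ` inside the window `ε₀`);
* §4 `FullModelMember`, `acrossSmall_full` — (v)⁺ across ANY family of such members with common letters.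
RATES (one row-sum rate `μ` with constant `c_μ` throughout): local data at walk rate `ρ₀`, window `ε₀`, torus rate `κ₀` with
`κ₀ + μ ≤ ρ₀ − ε₀`; the Neumann step needs `2μ ≤ ε₀` and `2μ ≤ κ₀` (two boundary row sums inside the window ∕ torus rate).
Nothing about Bałaban's `Γ_k(Z₀,σ,𝐔,𝐉)`, `Δ^{(k)}`, `C^{(k)}`; census instance of row (D4) = Bałaban's family: 0∕1 UNCHANGED.
-/

noncomputable section

namespace Summit.QuantumFields.BalabanUV.Gaps.D4WalkModelFull

open Metric Set Finset
open Literature.MathematicalPhysics.QuantumFieldTheory.Balaban1983to89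
open Literature.MathematicalPhysics.QuantumFieldTheory.Balaban1983to89.B9SectDWalk (Through MajSumLe DomBy)
open Literature.MathematicalPhysics.QuantumFieldTheory.Balaban1983to89.B9Thm34Ext (toB6)
open Literature.MathematicalPhysics.QuantumFieldTheory.Balaban1983to89.B9Thm37GlueTorus
  (torusGeom tdist1 tdist1_nonneg tdist1_self)
open Literature.MathematicalPhysics.QuantumFieldTheory.Balaban1983to89.TreeLengthTorus (TPt)
open Literature.MathematicalPhysics.QuantumFieldTheory.Balaban1983to89.B5TorusCover (UT)
open Literature.MathematicalPhysics.QuantumFieldTheory.Balaban1983to89.B11SectG (RowSum)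
open Literature.MathematicalPhysics.QuantumFieldTheory.Balaban1983to89.B13JointWalkExpansion (JointWalkExpansion WalkMajorants)
open Literature.MathematicalPhysics.QuantumFieldTheory.Balaban1983to89.B13TermWalkData
  (WalkConsts TermKernels TermWalkData TorusTerms)
open Literature.MathematicalPhysics.QuantumFieldTheory.Balaban1983to89.B13TermWalkDataOneTorus
  (SmallTheta ExistsUniformAcrossSmall acrossSmall_of_decay)
open Literature.MathematicalPhysics.QuantumFieldTheory.Balaban1983to89.B13LocalKernelWalks (LocalTerms)
open Summit.QuantumFields.BalabanUV.Gaps.D4WalkSum (jointWalkExpansion_add)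
open Summit.QuantumFields.BalabanUV.Gaps.D4WalkNeumann (jointWalkExpansion_inv)
open Summit.QuantumFields.BalabanUV.Gaps.D4WalkModelAcross (ModelTerm)

/-! ## §1. Transport along an equality of kernel families -/

section Transport

variable {ν : ℕ} {Nf : Fin ν → ℕ} [∀ i, NeZero (Nf i)]
variable {d N' : ℕ} {p n : Type}
variable {E : Type*} [NormedAddCommGroup E] [NormedSpace ℂ E]
variable {c₀ : B13.Consts} {locp : p → UT Nf} {locn : n → UT Nf} {X : Finset (UT Nf)}
variable {K K' : (TPt d N' → ℂ) → E → Matrix p n ℂ} {R ε kap Kbar ρ : ℝ}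
variable {W : Type} {T : W → (TPt d N' → ℂ) → E → Matrix p n ℂ} {SX : Set W} {A : W → ℝ} {D : W → UT Nf → UT Nf → ℝ}

/-- A joint walk expansion of `K` is one of any pointwise-equal family `K'` (the kernel enters only the `hasSum` field). -/
theorem jointWalkExpansion_congr (h : JointWalkExpansion c₀ locp locn K X R ε kap Kbar T SX A D ρ)
    (hK : ∀ σ₀ u, K σ₀ u = K' σ₀ u) : JointWalkExpansion c₀ locp locn K' X R ε kap Kbar T SX A D ρ where
  hasSum σ₀ hσ₀ u hu i j := by rw [← hK]; exact h.hasSum σ₀ hσ₀ u hu i j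
  termAnalytic := h.termAnalytic
  maj := h.maj
  majSum := h.majSum
  indep := h.indep
  through := h.through
  A_nonneg := h.A_nonneg
  D_nonneg := h.D_nonneg

omit [NormedSpace ℂ E] in
/-- The covariance-slot triple of a joint walk expansion, transported to a pointwise-equal family (`ε ≥ 0`: full-rate
majorants from the windowed ones, `JointWalkExpansion.majSum_full`). -/
theorem walkMajorants_congr [NormedSpace ℂ E] (h : JointWalkExpansion c₀ locp locn K X R ε kap Kbar T SX A D ρ)
    (hε : 0 ≤ ε) (hK : ∀ σ₀ u, K σ₀ u = K' σ₀ u) : WalkMajorants c₀ locp locn K' R kap Kbar T A D ρ where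
  hasSum σ₀ hσ₀ u hu i j := by rw [← hK]; exact h.hasSum σ₀ hσ₀ u hu i j
  maj := h.maj
  majSum := h.majSum_full hε
  A_nonneg := h.A_nonneg

end Transport

/-! ## §2. The full model term: local Γ-kernel `G`, local precision direction `H`, real symmetric reference -/

section Model

variable {d N' : ℕ} {ν : ℕ} {Nf : Fin ν → ℕ} [∀ i, NeZero (Nf i)]
variable {E : Type*} [NormedAddCommGroup E] [NormedSpace ℂ E]

/-- FULL MODEL TERM DATUM (Type-valued, nothing asserted): row bonds `Λ`, extra columns `C₀`, locators, σ-region `X`, fibre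
bound `m`, a local datum `G` for the Γ-kernel `Λ × (Λ ⊕ C₀)` and a local datum `H` for the precision direction `Λ × Λ`, both
with real reference values at `(σ,u) = (0,0)`. -/
structure FullModelTerm (d N' ν : ℕ) (Nf : Fin ν → ℕ) [∀ i, NeZero (Nf i)]
    (E : Type*) [NormedAddCommGroup E] [NormedSpace ℂ E] where
  Λ : Type
  [instFintype : Fintype Λ]
  [instDecEq : DecidableEq Λ]
  C₀ : Type
  locΛ : Λ → UT Nf
  locN : Λ ⊕ C₀ → UT Nf
  X : Finset (UT Nf)
  m : ℕ
  hfib : ∀ x : UT Nf, (Finset.univ.filter fun i => locΛ i = x).card ≤ m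
  G : LocalTerms d N' ν Nf Λ (Λ ⊕ C₀) E
  H : LocalTerms d N' ν Nf Λ Λ E
  hrealG : ∀ i j, (G.kernel 0 0 i j).im = 0
  hrealH : ∀ i j, (H.kernel 0 0 i j).im = 0

/-- The row index of a full model term is a finite type (bundled instance, exposed). -/
instance FullModelTerm.instFintypeΛ (t : FullModelTerm d N' ν Nf E) : Fintype t.Λ := t.instFintype

/-- The row index of a full model term has decidable equality (bundled instance, exposed). -/
instance FullModelTerm.instDecEqΛ (t : FullModelTerm d N' ν Nf E) : DecidableEq t.Λ := t.instDecEq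

namespace FullModelTerm

variable (c : B13.Consts) (t : FullModelTerm d N' ν Nf E)

/-- The real reference precision direction `H₀ = Re H(0,0)`. -/
def refH : Matrix t.Λ t.Λ ℝ := (t.H.kernel 0 0).map Complex.re

/-- `H(0,0)` is the complexification of `H₀` (its imaginary parts vanish). -/
theorem kernel_zero_eq : t.H.kernel 0 0 = t.refH.map (algebraMap ℝ ℂ) := by
  ext i j
  simp only [refH, Matrix.map_apply]
  apply Complex.ext
  · simp
  · simp [t.hrealH i j]

/-- `1 + H(0,0)` is the complexification of `1 + H₀`. -/
theorem one_add_kernel_zero_eq :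
    (1 : Matrix t.Λ t.Λ ℂ) + t.H.kernel 0 0 = ((1 : Matrix t.Λ t.Λ ℝ) + t.refH).map (algebraMap ℝ ℂ) := by
  rw [kernel_zero_eq]
  ext i j
  simp only [Matrix.add_apply, Matrix.map_apply, Matrix.one_apply, map_add]
  split_ifs <;> simp

/-- The model `TermKernels` record: `A2 = 1 + H`, `G2 = G`, `Γ₀ = Re G(0,0)`, `C = (1 + H₀)⁻¹`; `hC0` proved (the inverse of the
complexification is the complexification of the inverse, `1 + H₀` being invertible), `hC` from the named input
`hpos : (1 + H₀).PosDef` (`Matrix.PosDef.inv`). -/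
def toKernels (hpos : ((1 : Matrix t.Λ t.Λ ℝ) + t.refH).PosDef) : TermKernels c d N' ν Nf E where
  Λ := t.Λ
  C₀ := t.C₀
  A2 := fun σ u => 1 + t.H.kernel σ u
  G2 := t.G.kernel
  Γ₀ := (t.G.kernel 0 0).map Complex.re
  C := ((1 : Matrix t.Λ t.Λ ℝ) + t.refH)⁻¹
  locΛ := t.locΛ
  locN := t.locN
  X := t.X
  m := t.m
  hfib := t.hfib
  hG0 := by
    ext i j
    simp only [Matrix.map_apply]
    apply Complex.ext
    · simp
    · simp [t.hrealG i j]
  hC0 := by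
    have hdet : IsUnit ((1 : Matrix t.Λ t.Λ ℝ) + t.refH).det := (Matrix.isUnit_iff_isUnit_det _).1 hpos.isUnit
    show ((1 : Matrix t.Λ t.Λ ℂ) + t.H.kernel 0 0)⁻¹ = (((1 : Matrix t.Λ t.Λ ℝ) + t.refH)⁻¹).map (algebraMap ℝ ℂ)
    rw [one_add_kernel_zero_eq]
    apply Matrix.inv_eq_right_inv
    rw [← Matrix.map_mul, Matrix.mul_nonsing_inv _ hdet, Matrix.map_one _ (map_zero _) (map_one _)]
  hC := hpos.inv

/-! ## §3. `TermWalkData` for the full model term with ONE package -/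

variable {c t}

/-- **`TermWalkData` FOR THE FULL MODEL TERM.**  Data: `G` local with letters `(R, λ_G, r, m_J, n_B)` and `H` with
`(R, λ_H, r, m_J, n_B)` (`λ_•, κ₁ ≥ 0`; the Neumann margin and `K̄_E, K̄_C` see only `λ_H` — print: *"each Δ′_π provides the
small factor"* — while `K̄_Γ` is free to be `O(1)`, g1-plan-1 N20-1); rates
`0 ≤ μ`, `2μ ≤ κ₀`, `2μ ≤ ε₀`, `κ₀ + μ ≤ ρ₀ − ε₀`; the row sum (2.61) at rate `μ` with constant `c_μ ≥ 0` on this torus; the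
Neumann margin `q = (mc_μ)·((mc_μ)·1·(1·K̄_H)·c_μ)·c_μ < 1` with `K̄_• = λ_•e^{κ₁m_J}e^{ρ₀r}·n_B·c_μ`; row bonds `R_σ`-far from
`X`.  Conclusion: `TermWalkData` with the package `(R, ε₀, κ₀ − 2μ, K̄_G, 1 + K̄_H, 1·(1 − q)⁻¹, R_σ)` — no letter depends on
the torus.
Γ-slot: `jointWalkExpansion_local` (torus rate weakened by `.mono`); precision slot: identity ⊕ `H` (`jointWalkExpansion_add`);
covariance slot: `(1 + H)⁻¹` by `D4WalkNeumann.jointWalkExpansion_inv` with seed the identity and direction `H` (chain rate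
`ρ₀ − 2μ`, window `ε₀ − 2μ`, torus rate `κ₀ − 2μ`), transported along `1·H = H`. -/
theorem termWalkData {R lamG lamH r : ℝ} {mJ nB : ℕ}
    (hG : t.G.IsLocal c t.locΛ t.locN t.X R lamG r mJ nB) (hH : t.H.IsLocal c t.locΛ t.locΛ t.X R lamH r mJ nB)
    (hκ₁ : 0 ≤ c.κ₁) (hlamG : 0 ≤ lamG) (hlamH : 0 ≤ lamH) {ρ₀ ε₀ κ₀ μ cμ Rσ : ℝ} (hμ : 0 ≤ μ) (hμκ : 2 * μ ≤ κ₀)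
    (hμε : 2 * μ ≤ ε₀) (hwin : κ₀ + μ ≤ ρ₀ - ε₀) (hcμ : 0 ≤ cμ) (hrow : RowSum (toB6 (torusGeom Nf 0 0 0) 0 True) μ cμ)
    (hq : (t.m * cμ) * ((t.m * cμ) * 1 * (1 * ((lamH * Real.exp (c.κ₁ * mJ) * Real.exp (ρ₀ * r)) * (nB * cμ))) * cμ) * cμ < 1)
    (hpos : ((1 : Matrix t.Λ t.Λ ℝ) + t.refH).PosDef)
    (hfar : ∀ b : t.Λ, ∀ z ∈ t.X, Rσ ≤ tdist1 Nf (t.locΛ b) z) :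
    TermWalkData (t.toKernels c hpos)
      ⟨R, ε₀, κ₀ - 2 * μ, (lamG * Real.exp (c.κ₁ * mJ) * Real.exp (ρ₀ * r)) * (nB * cμ),
        1 + (lamH * Real.exp (c.κ₁ * mJ) * Real.exp (ρ₀ * r)) * (nB * cμ),
        1 * (1 - (t.m * cμ) * ((t.m * cμ) * 1 * (1 * ((lamH * Real.exp (c.κ₁ * mJ) * Real.exp (ρ₀ * r)) * (nB * cμ))) * cμ)
          * cμ)⁻¹, Rσ⟩ := by
  -- abbreviations and elementary rate facts
  have hκ₀ : 0 ≤ κ₀ := by linarith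
  have hρ₀ : 0 ≤ ρ₀ := by linarith
  have hε₀ : 0 ≤ ε₀ := by linarith
  have hKG : 0 ≤ (lamG * Real.exp (c.κ₁ * mJ) * Real.exp (ρ₀ * r)) * (nB * cμ) := by positivity
  have hK : 0 ≤ (lamH * Real.exp (c.κ₁ * mJ) * Real.exp (ρ₀ * r)) * (nB * cμ) := by positivity
  -- the two local expansions at (ρ₀, ε₀, κ₀)
  have hGw := LocalTerms.jointWalkExpansion_local hG hκ₁ hlamG hρ₀ hκ₀ hμ hwin hrow
  have hHw := LocalTerms.jointWalkExpansion_local hH hκ₁ hlamH hρ₀ hκ₀ hμ hwin hrow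
  refine ⟨?_, ?_, ?_, hfar⟩
  · -- Γ-slot: torus rate weakened to κ₀ − 2μ
    exact ⟨t.G.B, t.G.term, t.G.sigmaCarrying, fun _ => lamG * Real.exp (c.κ₁ * mJ) * Real.exp (ρ₀ * r), t.G.dist, ρ₀,
      hGw.mono le_rfl le_rfl (by linarith) hKG le_rfl⟩
  · -- precision slot: identity ⊕ H
    have hone := ModelTerm.jointWalkExpansion_one (d := d) (N' := N') (E := E) c t.locΛ t.X R ε₀ (ρ₀ - ε₀)
    have hadd := jointWalkExpansion_add (ρ := ρ₀) (ε := ε₀) (κ := κ₀ - 2 * μ) hone hHw (by linarith) le_rfl (by linarith)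
      le_rfl (by linarith) (by linarith) zero_le_one hK
    exact ⟨_, _, _, _, _, _, hadd⟩
  · -- covariance slot: (1 + H)⁻¹ by the Neumann step, seed = identity, direction = H
    have hone := ModelTerm.jointWalkExpansion_one (d := d) (N' := N') (E := E) c t.locΛ t.X R (ε₀ - μ) (ρ₀ - ε₀)
    have hinv := jointWalkExpansion_inv (A := fun (_ : TPt d N' → ℂ) (_ : E) => (1 : Matrix t.Λ t.Λ ℂ))
      (ρ := ρ₀ - 2 * μ) (ε := ε₀ - 2 * μ) (ρs := ρ₀ - μ) (κs := κ₀ - μ) (κ := κ₀ - 2 * μ)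
      hone hHw (fun _ a b => le_rfl) (fun b => t.H.domBy_dist b) (fun σ₀ _ u _ => Matrix.one_mul _) t.hfib hrow hrow hμ hμ
      hcμ hcμ (by linarith) (by linarith) (by linarith) (by linarith) (by linarith) (by linarith) (by linarith) zero_le_one hK
      (by linarith) (by linarith) (by linarith) (by linarith) (by linarith) (by linarith) hq
    refine ⟨_, _, _, _, _, walkMajorants_congr hinv (by linarith) fun σ₀ u => ?_⟩
    show ((1 : Matrix t.Λ t.Λ ℂ) + (1 : ℂ) • t.H.kernel σ₀ u)⁻¹ = ((1 : Matrix t.Λ t.Λ ℂ) + t.H.kernel σ₀ u)⁻¹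
    rw [one_smul]

end FullModelTerm

end Model

/-! ## §4. (v)⁺ across a family of full model members -/

section Across

variable {d : ℕ}

/-- FULL MODEL MEMBER of an exhausting family: own torus, configuration space, term index, and a full model term datum
per term together with the positivity input for its reference precision. -/
structure FullModelMember (d : ℕ) where
  N' : ℕ
  ν : ℕ
  Nf : Fin ν → ℕ
  [instNf : ∀ i, NeZero (Nf i)]
  E : Type
  [instE₁ : NormedAddCommGroup E]
  [instE₂ : NormedSpace ℂ E]
  ι : Type
  t : ι → FullModelTerm d N' ν Nf E
  hpos : ∀ i, ((1 : Matrix (t i).Λ (t i).Λ ℝ) + (t i).refH).PosDef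

/-- The member's torus side lengths are non-zero (bundled instance, exposed). -/
instance FullModelMember.instNeZeroNf (M : FullModelMember d) (i : Fin M.ν) : NeZero (M.Nf i) := M.instNf i

/-- The member's configuration space is a normed group (bundled instance, exposed). -/
instance FullModelMember.instNormedAddCommGroupE (M : FullModelMember d) : NormedAddCommGroup M.E := M.instE₁

/-- The member's configuration space is a complex normed space (bundled instance, exposed). -/
instance FullModelMember.instNormedSpaceE (M : FullModelMember d) : NormedSpace ℂ M.E := M.instE₂

/-- The member as a `TorusTerms` record. -/
def FullModelMember.toTorusTerms (c : B13.Consts) (M : FullModelMember d) : TorusTerms c d where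
  N' := M.N'
  ν := M.ν
  Nf := M.Nf
  E := M.E
  ι := M.ι
  𝒦 := fun i => (M.t i).toKernels c (M.hpos i)

variable {c : B13.Consts}

/-- **(v)⁺ ACROSS A FAMILY OF FULL MODEL MEMBERS — all three mechanisms, ONE package.**  Common locality letters for every
`G` and `H`, common row-sum rate `μ` and constant `c_μ` on every member's torus, common rates `(ρ₀, ε₀, κ₀)` with
`2μ ≤ κ₀`, `2μ ≤ ε₀`, `κ₀ + μ ≤ ρ₀ − ε₀`, `0 < κ₀ − 2μ`, the margin `q(λ_H) < 1` on every term (its only term-dependence is the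
fibre bound `m`, asked as a common value `m₀`), `hfar` at `Rσ₀`, and the numerics `0 ≤ α < R`,
`2·max(K̄_G, 1 + K̄_H)·(e^{−ε₀Rσ₀} + α∕R) ≤ θ₀` ⟹ `ExistsUniformAcrossSmall` for the family with the package of §3, via
`acrossSmall_of_decay`.  Census instance of row (D4) (Bałaban's family): 0∕1 UNCHANGED. -/
theorem acrossSmall_full {S : Type*} (𝓜 : S → FullModelMember d) {R lamG lamH r : ℝ} {mJ nB m₀ : ℕ}
    {ρ₀ ε₀ κ₀ μ cμ Rσ₀ α θ₀ : ℝ}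
    (hm : ∀ s (i : (𝓜 s).ι), ((𝓜 s).t i).m = m₀)
    (hG : ∀ s (i : (𝓜 s).ι), ((𝓜 s).t i).G.IsLocal c ((𝓜 s).t i).locΛ ((𝓜 s).t i).locN ((𝓜 s).t i).X R lamG r mJ nB)
    (hH : ∀ s (i : (𝓜 s).ι), ((𝓜 s).t i).H.IsLocal c ((𝓜 s).t i).locΛ ((𝓜 s).t i).locΛ ((𝓜 s).t i).X R lamH r mJ nB)
    (hrow : ∀ s, RowSum (toB6 (torusGeom (𝓜 s).Nf 0 0 0) 0 True) μ cμ)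
    (hfar : ∀ s (i : (𝓜 s).ι) (b : ((𝓜 s).t i).Λ), ∀ z ∈ ((𝓜 s).t i).X, Rσ₀ ≤ tdist1 (𝓜 s).Nf (((𝓜 s).t i).locΛ b) z)
    (hκ₁ : 0 ≤ c.κ₁) (hlamG : 0 ≤ lamG) (hlamH : 0 ≤ lamH) (hμ : 0 ≤ μ) (hμκ : 2 * μ < κ₀) (hμε : 2 * μ ≤ ε₀)
    (hwin : κ₀ + μ ≤ ρ₀ - ε₀) (hcμ : 0 ≤ cμ)
    (hq : (m₀ * cμ) * ((m₀ * cμ) * 1 * (1 * ((lamH * Real.exp (c.κ₁ * mJ) * Real.exp (ρ₀ * r)) * (nB * cμ))) * cμ) * cμ < 1)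
    (hα : 0 ≤ α) (hαR : α < R)
    (hθ : 2 * max ((lamG * Real.exp (c.κ₁ * mJ) * Real.exp (ρ₀ * r)) * (nB * cμ)) (1 + (lamH * Real.exp (c.κ₁ * mJ) * Real.exp (ρ₀ * r)) * (nB * cμ)) * (Real.exp (-(ε₀ * Rσ₀)) + α / R) ≤ θ₀) :
    ExistsUniformAcrossSmall (fun s => (𝓜 s).toTorusTerms c) α Rσ₀ θ₀ := by
  have hKG : 0 ≤ (lamG * Real.exp (c.κ₁ * mJ) * Real.exp (ρ₀ * r)) * (nB * cμ) := by positivity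
  have hK : 0 ≤ (lamH * Real.exp (c.κ₁ * mJ) * Real.exp (ρ₀ * r)) * (nB * cμ) := by positivity
  have hq1 : 0 < 1 - (m₀ * cμ) * ((m₀ * cμ) * 1 * (1 * ((lamH * Real.exp (c.κ₁ * mJ) * Real.exp (ρ₀ * r)) * (nB * cμ))) * cμ)
      * cμ := by linarith
  refine acrossSmall_of_decay
    ⟨R, ε₀, κ₀ - 2 * μ, (lamG * Real.exp (c.κ₁ * mJ) * Real.exp (ρ₀ * r)) * (nB * cμ),
      1 + (lamH * Real.exp (c.κ₁ * mJ) * Real.exp (ρ₀ * r)) * (nB * cμ),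
      1 * (1 - (m₀ * cμ) * ((m₀ * cμ) * 1 * (1 * ((lamH * Real.exp (c.κ₁ * mJ) * Real.exp (ρ₀ * r)) * (nB * cμ))) * cμ)
        * cμ)⁻¹, Rσ₀⟩
    ⟨hαR, by linarith, by linarith, hKG, by linarith, by positivity, le_rfl⟩ (fun s i => ?_) (le_max_left _ _)
    (le_max_right _ _) hα hθ
  have h := FullModelTerm.termWalkData (hG s i) (hH s i) hκ₁ hlamG hlamH hμ hμκ.le hμε hwin hcμ (hrow s)
    (by rw [hm s i]; exact hq) ((𝓜 s).hpos i) (hfar s i)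
  rw [hm s i] at h
  exact h

end Across

end Summit.QuantumFields.BalabanUV.Gaps.D4WalkModelFull

end
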